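import Mathlib.NumberTheory.Padics.RingHoms
import Mathlib.Algebra.Module.Torsion.Basic
import Mathlib.GroupTheory.Torsion
import Mathlib.RepresentationTheory.Basic
import Mathlib.LinearAlgebra.TensorProduct.Tower
import Mathlib.LinearAlgebra.Dimension.Finrank
import Mathlib.LinearAlgebra.FreeModule.Basic
import Mathlib.Topology.Algebra.Module.ModuleTopology
import Literature.NumberTheory.EllipticCurves.GaloisAction
import Literature.NumberTheory.GaloisRepresentations.GaloisRep
import HarnessLib

-- provenance: harness21/H21/H21/Prelude/EllArithM/TateModule.lean @ 46c1cf4 (interim HEAD d8f2665); M5 mechanical rewrite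
/-!
# Tate modules of abelian groups and of elliptic curves

Trunk EllArithM (group G16, outline item C1 `TateModule`); notion `tate_module`.

## Contents

* Generic part (namespace `Literature`). For an abelian group `A` and a natural number `p`, the
  **Tate module** `T_p A = lim← A[p^n]` is realised as the subgroup
  `Literature.tateSubgroup A p ≤ (ℕ → A)` of *compatible sequences* `(a_n)_n` with `p ^ n • a_n = 0`
  and `p • a_{n+1} = a_n`, packaged as the type synonym `Literature.TateModule A p` with:
  the subspace topology of `ℕ → A` (product topology; for discrete `A` this is the profinite
  topology of the inverse limit), the structure of `ℤ_[p]`-module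
  (`x • a)_n = (x mod p^n) • a_n`, all axioms proved), projections `TateModule.proj n`,
  functoriality `TateModule.map`, the induced action of any monoid acting on `A` by group
  automorphisms and the resulting representation `Literature.tateRepresentation G A p :
  Representation ℤ_[p] G (TateModule A p)`.
* `Literature.RationalTateModule A p = V_p A := ℚ_[p] ⊗_{ℤ_[p]} T_p A`, a `def` type synonym carrying
  the module topology over `ℚ_[p]` (`IsModuleTopology`), and `Literature.NumberTheory.EllipticCurves.rationalTateRepresentation`.
* The `p`-primary torsion `A[p^∞]` is Mathlib's `AddCommGroup.primaryComponent A p`; we only add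
  the induced `DistribMulAction`.
* Elliptic-curve part (namespace `WeierstrassCurve`, deliberate dot-notation extensions): for a
  Weierstrass curve `W` over a field `F`, `W.tateModule p = T_p E := TateModule (geomPoints W) p`
  (`geomPoints W = E(F̄)` with its `Γ_F`-action, from `Literature.Prelude.TranscendEllArithS.GaloisAction`),
  `W.rationalTateModule p = V_p E`, `W.geomPrimaryTorsion p = E[p^∞]`, the Galois representations
  `W.galoisRepTate p : Representation ℤ_[p] Γ_F (T_p E)` and `W.rationalGaloisRepTate p`, the
  standard structure theorems (sorried: `T_p E ≅ ℤ_p²` for `p ≠ char F`, continuity of the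
  Galois action) and the glue `W.tateGaloisRep p h : Literature.GaloisRep F ℤ_[p] (T_p E)` to the
  Galois-representation API of `Literature.Prelude.GalRep.GaloisRep`, with the continuity proof `h` an
  explicit argument (supplied by `continuous_galoisRepTate`).

## Mathlib

Mathlib has no Tate module of an abelian group or elliptic curve (grep `TateModule`, `Tate` in
`Mathlib/AlgebraicGeometry/EllipticCurve`, `Mathlib/GroupTheory`); it has `PadicInt.toZModPow`,
`PadicInt.cast_toZModPow` (compatibility of the reductions `ℤ_[p] → ℤ/p^n`),
`AddSubgroup.torsionBy` (`A[n]`), `AddCommGroup.primaryComponent`, `Representation`,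
`Representation.ofDistribMulAction`, `LinearMap.baseChange`, `moduleTopology`/`IsModuleTopology`,
all of which are used here.

## Design choices

* `noncomputable section`, `open scoped Classical`, no `[DecidableEq]` variables (G06 §0 rule);
  one named universe `u` for the abelian group / base field (the Galois-cohomology files need
  universe-monomorphic carriers).
* `TateModule` and `RationalTateModule` are `def` type synonyms (not `abbrev`s), so that the
  instances put on them (topology, `ℤ_[p]`-module structure) do not leak to `ℕ → A` or to Mathlib's
  `TensorProduct`.
* The `ℤ_[p]`-action is defined by `(x • a)_n := (PadicInt.toZModPow n x).val • a_n`; the module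
  axioms reduce to `AddSubgroup.torsionBy.mod_self_nsmul'`.
* `Module.Free ℤ_[p] (T_p E)`, `Module.Finite`, `finrank = 2` and continuity are *sorried theorems*
  (Silverman, *AEC*, III.7.1); downstream files consume them only as explicit hypotheses, never
  as instances, and no definition depends on a sorried proof.

## References

* J. H. Silverman, *The Arithmetic of Elliptic Curves*, III.§7 (Tate module), III.6.4, V.§3.
* J.-P. Serre, *Abelian ℓ-adic representations and elliptic curves* (1968), Ch. I §1.1–1.2.
* J. Tate, *Endomorphisms of abelian varieties over finite fields*, Invent. Math. 2 (1966), §1.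
-/

noncomputable section

open scoped Classical
open scoped AddSubgroup TensorProduct

universe u v

namespace Literature.NumberTheory.EllipticCurves

/-! ## The Tate module of an abelian group -/

section Generic

variable (A : Type u) [AddCommGroup A] (p : ℕ)

/-- The Tate module `T_p A` of an abelian group `A`, as the subgroup of `ℕ → A` of compatible
sequences `(a_n)` with `p ^ n • a_n = 0` and `p • a_{n+1} = a_n` (the inverse limit
`lim← A[p^n]` along multiplication by `p`). Silverman, *AEC*, III.§7; Serre (1968), I.1.1. [cite: Serre1968] -/
def tateSubgroup : AddSubgroup (ℕ → A) where
  carrier := {a | (∀ n, p ^ n • a n = 0) ∧ ∀ n, p • a (n + 1) = a n}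
  add_mem' := by
    rintro a b ⟨ha, ha'⟩ ⟨hb, hb'⟩
    exact ⟨fun n ↦ by simp [smul_add, ha n, hb n], fun n ↦ by simp [smul_add, ha' n, hb' n]⟩
  zero_mem' := ⟨fun n ↦ by simp, fun n ↦ by simp⟩
  neg_mem' := by
    rintro a ⟨ha, ha'⟩
    exact ⟨fun n ↦ by simp [ha n], fun n ↦ by simp [ha' n]⟩

/-- Membership in `tateSubgroup A p`. Silverman, *AEC*, III.§7. [folklore] -/
theorem mem_tateSubgroup_iff {a : ℕ → A} :
    a ∈ tateSubgroup A p ↔ (∀ n, p ^ n • a n = 0) ∧ ∀ n, p • a (n + 1) = a n :=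
  Iff.rfl

/-- The **Tate module** `T_p A = lim← A[p^n]` of an abelian group `A` (type synonym for
`Literature.tateSubgroup A p`). Silverman, *AEC*, III.§7; Serre (1968), I.1.1. [cite: Serre1968] -/
def TateModule : Type u := tateSubgroup A p

namespace TateModule

/-- `T_p A` is an abelian group (as a subgroup of `ℕ → A`). Silverman, *AEC*, III.§7. [folklore] -/
instance instAddCommGroup : AddCommGroup (TateModule A p) :=
  inferInstanceAs (AddCommGroup (tateSubgroup A p))

/-- The topology on `T_p A` induced from the product topology on `ℕ → A`; for discrete `A` this
is the profinite (inverse-limit) topology. Serre (1968), I.1.1. [cite: Serre1968] -/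
instance instTopologicalSpace [TopologicalSpace A] : TopologicalSpace (TateModule A p) :=
  inferInstanceAs (TopologicalSpace (tateSubgroup A p))

/-- `T_p A` is a topological group for the subspace topology. Serre (1968), I.1.1. [cite: Serre1968] -/
instance instIsTopologicalAddGroup [TopologicalSpace A] [IsTopologicalAddGroup A] :
    IsTopologicalAddGroup (TateModule A p) :=
  inferInstanceAs (IsTopologicalAddGroup (tateSubgroup A p))

variable {A p}

/-- Build an element of `T_p A` from a compatible sequence. Silverman, *AEC*, III.§7. [folklore] -/
def mk (a : ℕ → A) (h : ∀ n, p ^ n • a n = 0) (h' : ∀ n, p • a (n + 1) = a n) :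
    TateModule A p :=
  ⟨a, h, h'⟩

variable (p) in
/-- The `n`-th projection `T_p A →+ A`, `(a_m)_m ↦ a_n` (with values in `A[p^n]`, see
`proj_mem_torsionBy`). Silverman, *AEC*, III.§7. [folklore] -/
def proj (n : ℕ) : TateModule A p →+ A where
  toFun a := a.1 n
  map_zero' := rfl
  map_add' _ _ := rfl

/-- Components of `TateModule.mk`. [folklore] -/
@[simp]
theorem proj_mk (a : ℕ → A) (h : ∀ n, p ^ n • a n = 0) (h' : ∀ n, p • a (n + 1) = a n)
    (n : ℕ) : proj p n (mk a h h') = a n :=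
  rfl

/-- Two elements of `T_p A` with the same components are equal. Silverman, *AEC*, III.§7. [folklore] -/
@[ext]
theorem ext {a b : TateModule A p} (h : ∀ n, proj p n a = proj p n b) : a = b :=
  Subtype.ext (funext h)

/-- The components of an element of `T_p A` are killed by `p ^ n`. Silverman, *AEC*, III.§7. [folklore] -/
@[simp]
theorem pow_smul_proj (n : ℕ) (a : TateModule A p) : p ^ n • proj p n a = 0 :=
  a.2.1 n

/-- The `n`-th component of an element of `T_p A` lies in `A[p^n]`. Silverman, *AEC*, III.§7. [folklore] -/
theorem proj_mem_torsionBy (n : ℕ) (a : TateModule A p) : proj p n a ∈ A[(p ^ n : ℕ)] :=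
  AddSubgroup.torsionBy.nsmul_iff.mpr (a.2.1 n)

/-- Compatibility of the components: `p • a_{n+1} = a_n`. Silverman, *AEC*, III.§7. [folklore] -/
@[simp]
theorem smul_proj_succ (n : ℕ) (a : TateModule A p) : p • proj p (n + 1) a = proj p n a :=
  a.2.2 n

/-- The projections `T_p A → A` are continuous. Serre (1968), I.1.1. [cite: Serre1968] -/
theorem continuous_proj [TopologicalSpace A] (n : ℕ) : Continuous (proj p n : TateModule A p → A) :=
  (continuous_apply n).comp continuous_subtype_val

/-! ### The `ℤ_[p]`-module structure -/

section Module

variable [Fact p.Prime]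

variable (p) in
/-- Compatibility of the reductions `ℤ_[p] → ℤ/p^n`: the residue mod `p ^ n` is the residue
mod `p ^ (n+1)` reduced mod `p ^ n` (Mathlib `PadicInt.cast_toZModPow`), on representatives. [folklore] -/
theorem val_toZModPow_eq_mod (n : ℕ) (x : ℤ_[p]) :
    (PadicInt.toZModPow n x).val = (PadicInt.toZModPow (n + 1) x).val % p ^ n := by
  rw [← PadicInt.cast_toZModPow n (n + 1) n.le_succ x, ZMod.cast_eq_val, ZMod.val_natCast]

/-- The scalar action of `ℤ_[p]` on `T_p A`: `(x • a)_n := (x mod p^n) • a_n`, well defined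
since `a_n ∈ A[p^n]`. Silverman, *AEC*, III.§7; Serre (1968), I.1.1. [cite: Serre1968] -/
instance instSMulPadicInt : SMul ℤ_[p] (TateModule A p) where
  smul x a := mk (fun n ↦ (PadicInt.toZModPow n x).val • proj p n a)
    (fun n ↦ by rw [smul_comm, pow_smul_proj, smul_zero])
    (fun n ↦ by
      rw [smul_comm, smul_proj_succ, val_toZModPow_eq_mod p n x]
      exact AddSubgroup.torsionBy.mod_self_nsmul' _ (proj_mem_torsionBy n a))

/-- Components of the `ℤ_[p]`-action: `(x • a)_n = (x mod p^n) • a_n`. Silverman, *AEC*, III.§7. [folklore] -/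
@[simp]
theorem proj_smul (x : ℤ_[p]) (a : TateModule A p) (n : ℕ) :
    proj p n (x • a) = (PadicInt.toZModPow n x).val • proj p n a :=
  rfl

/-- `T_p A` is a `ℤ_[p]`-module via `(x • a)_n = (x mod p^n) • a_n` (all axioms proved from
`AddSubgroup.torsionBy.mod_self_nsmul'`). Silverman, *AEC*, III.§7; Serre (1968), I.1.1. [cite: Serre1968] -/
instance instModulePadicInt : Module ℤ_[p] (TateModule A p) where
  one_smul a := TateModule.ext fun n ↦ by
    rw [proj_smul, map_one, ZMod.val_one_eq_one_mod,
      ← AddSubgroup.torsionBy.mod_self_nsmul' _ (proj_mem_torsionBy n a), one_smul]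
  mul_smul x y a := TateModule.ext fun n ↦ by
    rw [proj_smul, proj_smul, proj_smul, map_mul, ZMod.val_mul,
      ← AddSubgroup.torsionBy.mod_self_nsmul' _ (proj_mem_torsionBy n a), mul_smul]
  smul_zero x := TateModule.ext fun n ↦ by rw [proj_smul, map_zero, smul_zero]
  smul_add x a b := TateModule.ext fun n ↦ by simp only [proj_smul, map_add, smul_add]
  add_smul x y a := TateModule.ext fun n ↦ by
    rw [map_add, proj_smul, proj_smul, proj_smul, map_add, ZMod.val_add,
      ← AddSubgroup.torsionBy.mod_self_nsmul' _ (proj_mem_torsionBy n a), add_smul]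
  zero_smul a := TateModule.ext fun n ↦ by
    rw [proj_smul, map_zero, ZMod.val_zero, zero_smul, map_zero]

/-- The scalar action of `ℤ_[p]` on `T_p A` is by continuous maps (it is componentwise an
`ℕ`-multiple). Serre (1968), I.1.1. [cite: Serre1968] -/
instance instContinuousConstSMul [TopologicalSpace A] [ContinuousAdd A] :
    ContinuousConstSMul ℤ_[p] (TateModule A p) where
  continuous_const_smul x := by
    refine continuous_induced_rng.mpr (continuous_pi fun n ↦ ?_)
    exact (continuous_nsmul _).comp (continuous_proj n)

end Module

/-! ### Functoriality -/

section Map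

variable {B : Type v} [AddCommGroup B] {C : Type*} [AddCommGroup C]

variable (p) in
/-- Functoriality of `T_p`: an additive map `f : A →+ B` induces `T_p f : T_p A → T_p B`,
`(a_n) ↦ (f a_n)`, as an additive map (see `map` for the `ℤ_[p]`-linear version).
Silverman, *AEC*, III.§7. [folklore] -/
def mapAddMonoidHom (f : A →+ B) : TateModule A p →+ TateModule B p where
  toFun a := mk (fun n ↦ f (proj p n a)) (fun n ↦ by rw [← map_nsmul, pow_smul_proj, map_zero])
    (fun n ↦ by rw [← map_nsmul, smul_proj_succ])
  map_zero' := TateModule.ext fun n ↦ map_zero f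
  map_add' a b := TateModule.ext fun n ↦ map_add f _ _

/-- Components of `mapAddMonoidHom`. [folklore] -/
@[simp]
theorem proj_mapAddMonoidHom (f : A →+ B) (a : TateModule A p) (n : ℕ) :
    proj p n (mapAddMonoidHom p f a) = f (proj p n a) :=
  rfl

variable [Fact p.Prime]

variable (p) in
/-- Functoriality of `T_p`: an additive map `f : A →+ B` induces the `ℤ_[p]`-linear map
`T_p f : T_p A →ₗ[ℤ_[p]] T_p B`, `(a_n) ↦ (f a_n)`. Silverman, *AEC*, III.§7 (e.g. `f` an
isogeny, III.7.4). [folklore] -/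
def map (f : A →+ B) : TateModule A p →ₗ[ℤ_[p]] TateModule B p where
  toFun := mapAddMonoidHom p f
  map_add' := map_add _
  map_smul' x a := TateModule.ext fun n ↦ by simp [map_nsmul]

/-- Components of `TateModule.map`. [folklore] -/
@[simp]
theorem proj_map (f : A →+ B) (a : TateModule A p) (n : ℕ) :
    proj p n (map p f a) = f (proj p n a) :=
  rfl

/-- `T_p` of the identity is the identity. [folklore] -/
@[simp]
theorem map_id : map p (AddMonoidHom.id A) = LinearMap.id :=
  LinearMap.ext fun _ ↦ TateModule.ext fun _ ↦ rfl

/-- `T_p` is compatible with composition. [folklore] -/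
theorem map_comp (g : B →+ C) (f : A →+ B) : map p (g.comp f) = (map p g).comp (map p f) :=
  LinearMap.ext fun _ ↦ TateModule.ext fun _ ↦ rfl

end Map

/-! ### Induced actions -/

section Action

variable {G : Type*} [Monoid G] [DistribMulAction G A]

/-- A distributive action of a monoid `G` on `A` induces a componentwise action on `T_p A`
(`(g • a)_n = g • a_n`; the action commutes with multiplication by `p`).
Silverman, *AEC*, III.§7 (for `G = Γ_F`, `A = E(F̄)`). [folklore] -/
instance instSMulOfDistribMulAction : SMul G (TateModule A p) where
  smul g a := mk (fun n ↦ g • proj p n a) (fun n ↦ by rw [smul_comm, pow_smul_proj, smul_zero])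
    (fun n ↦ by rw [smul_comm, smul_proj_succ])

/-- Components of the induced action: `(g • a)_n = g • a_n`. Silverman, *AEC*, III.§7. [folklore] -/
@[simp]
theorem proj_smul_of_distribMulAction (g : G) (a : TateModule A p) (n : ℕ) :
    proj p n (g • a) = g • proj p n a :=
  rfl

/-- The induced action of `G` on `T_p A` is by group automorphisms. Silverman, *AEC*, III.§7. [folklore] -/
instance instDistribMulAction : DistribMulAction G (TateModule A p) where
  one_smul _ := TateModule.ext fun _ ↦ one_smul G _
  mul_smul g h _ := TateModule.ext fun _ ↦ mul_smul g h _
  smul_zero g := TateModule.ext fun _ ↦ smul_zero g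
  smul_add g _ _ := TateModule.ext fun _ ↦ smul_add g _ _

/-- The induced action of `G` on `T_p A` is by homeomorphisms when `G` acts on `A` by continuous
maps. Serre (1968), I.1.1. [cite: Serre1968] -/
instance instContinuousConstSMulOfDistribMulAction [TopologicalSpace A] [ContinuousConstSMul G A] :
    ContinuousConstSMul G (TateModule A p) where
  continuous_const_smul g := by
    refine continuous_induced_rng.mpr (continuous_pi fun n ↦ ?_)
    exact (continuous_const_smul g).comp (continuous_proj n)

variable [Fact p.Prime]

/-- The induced `G`-action on `T_p A` commutes with the `ℤ_[p]`-action, i.e. `G` acts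
`ℤ_[p]`-linearly. Silverman, *AEC*, III.§7. [folklore] -/
instance instSMulCommClassPadicInt : SMulCommClass G ℤ_[p] (TateModule A p) where
  smul_comm g x a := TateModule.ext fun n ↦
    smul_comm g (PadicInt.toZModPow n x).val (proj p n a)

end Action

end TateModule

end Generic

section Representation

variable (G : Type*) [Monoid G] (A : Type u) [AddCommGroup A] [DistribMulAction G A] (p : ℕ)
  [Fact p.Prime]

/-- The `p`-adic representation `G → Aut_{ℤ_p}(T_p A)` induced by a distributive action of `G` on
`A` (Mathlib `Representation.ofDistribMulAction`). Silverman, *AEC*, III.§7; Serre (1968), I.1.1. [cite: Serre1968] -/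
def tateRepresentation : Representation ℤ_[p] G (TateModule A p) :=
  Representation.ofDistribMulAction ℤ_[p] G (TateModule A p)

variable {G A p} in
/-- Unfolding `tateRepresentation`: `ρ(g) a = g • a`. [folklore] -/
@[simp]
theorem tateRepresentation_apply_apply (g : G) (a : TateModule A p) :
    tateRepresentation G A p g a = g • a :=
  rfl

end Representation

/-! ### The `p`-primary torsion `A[p^∞]` -/

section Primary

variable {A : Type u} [AddCommGroup A] (p : ℕ) {G : Type*} [Monoid G] [DistribMulAction G A]

/-- A distributive action of `G` on `A` preserves the `p`-primary torsion subgroup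
`A[p^∞] = AddCommGroup.primaryComponent A p`. Silverman, *AEC*, III.§7. [folklore] -/
theorem smul_mem_primaryComponent (g : G) {a : A} (ha : a ∈ AddCommGroup.primaryComponent A p) :
    g • a ∈ AddCommGroup.primaryComponent A p := by
  obtain ⟨k, hk⟩ := ha
  exact ⟨k, by rw [smul_comm, hk, smul_zero]⟩

/-- The induced action of `G` on the `p`-primary torsion `A[p^∞]` (Mathlib's
`AddCommGroup.primaryComponent A p`), by group automorphisms. Silverman, *AEC*, III.§7. [folklore] -/
instance primaryComponent.instDistribMulAction :
    DistribMulAction G (AddCommGroup.primaryComponent A p) where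
  smul g a := ⟨g • (a : A), smul_mem_primaryComponent p g a.2⟩
  one_smul a := Subtype.ext (one_smul G (a : A))
  mul_smul g h a := Subtype.ext (mul_smul g h (a : A))
  smul_zero g := Subtype.ext (smul_zero g)
  smul_add g a b := Subtype.ext (smul_add g (a : A) b)

/-- Unfolding lemma for the action on `A[p^∞]`. [folklore] -/
@[simp]
theorem primaryComponent.coe_smul (g : G) (a : AddCommGroup.primaryComponent A p) :
    ((g • a : AddCommGroup.primaryComponent A p) : A) = g • (a : A) :=
  rfl

end Primary

/-! ## The rational Tate module `V_p A = ℚ_p ⊗ T_p A` -/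

section Rational

variable (G : Type*) [Monoid G] (A : Type u) [AddCommGroup A] (p : ℕ) [Fact p.Prime]

/-- The **rational Tate module** `V_p A := ℚ_[p] ⊗_{ℤ_[p]} T_p A` (a `def` type synonym of
Mathlib's tensor product, so that the module topology below stays local to it).
Silverman, *AEC*, III.§7 (Remark 7.2 ff.); Serre (1968), I.1.1–1.2. [cite: Serre1968] -/
def RationalTateModule : Type u := ℚ_[p] ⊗[ℤ_[p]] TateModule A p

namespace RationalTateModule

/-- `V_p A` is an abelian group. Serre (1968), I.1.1. [cite: Serre1968] -/
instance instAddCommGroup : AddCommGroup (RationalTateModule A p) :=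
  inferInstanceAs (AddCommGroup (ℚ_[p] ⊗[ℤ_[p]] TateModule A p))

/-- `V_p A` is a `ℚ_[p]`-vector space. Serre (1968), I.1.1. [cite: Serre1968] -/
instance instModulePadic : Module ℚ_[p] (RationalTateModule A p) :=
  inferInstanceAs (Module ℚ_[p] (ℚ_[p] ⊗[ℤ_[p]] TateModule A p))

/-- `V_p A` is a `ℤ_[p]`-module (restriction of scalars). Serre (1968), I.1.1. [cite: Serre1968] -/
instance instModulePadicInt : Module ℤ_[p] (RationalTateModule A p) :=
  inferInstanceAs (Module ℤ_[p] (ℚ_[p] ⊗[ℤ_[p]] TateModule A p))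

/-- The `ℤ_[p]`- and `ℚ_[p]`-module structures on `V_p A` are compatible. Serre (1968), I.1.1. [cite: Serre1968] -/
instance instIsScalarTower : IsScalarTower ℤ_[p] ℚ_[p] (RationalTateModule A p) :=
  inferInstanceAs (IsScalarTower ℤ_[p] ℚ_[p] (ℚ_[p] ⊗[ℤ_[p]] TateModule A p))

/-- `V_p A` is a free `ℚ_[p]`-module (every vector space is). [folklore] -/
instance instFree : Module.Free ℚ_[p] (RationalTateModule A p) := inferInstance

/-- `V_p A` carries the module topology over `ℚ_[p]` (Mathlib `moduleTopology`; for `V_p A`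
finite-dimensional this is the usual `p`-adic topology of `ℚ_p^d`). Serre (1968), I.1.1;
convention G09 D1. [cite: Serre1968] -/
instance instTopologicalSpace : TopologicalSpace (RationalTateModule A p) :=
  moduleTopology ℚ_[p] (RationalTateModule A p)

/-- The topology on `V_p A` is the module topology, by definition. Convention G09 D1. [folklore] -/
instance instIsModuleTopology : IsModuleTopology ℚ_[p] (RationalTateModule A p) := ⟨rfl⟩

/-- `V_p A` is a topological group for the module topology
(Mathlib `IsModuleTopology.topologicalAddGroup`). [folklore] -/
instance instIsTopologicalAddGroup : IsTopologicalAddGroup (RationalTateModule A p) :=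
  IsModuleTopology.topologicalAddGroup ℚ_[p] _

/-- Scalar multiplication on `V_p A` is continuous (Mathlib `IsModuleTopology.toContinuousSMul`). [folklore] -/
instance instContinuousSMul : ContinuousSMul ℚ_[p] (RationalTateModule A p) := inferInstance

end RationalTateModule

variable {A} in
/-- The canonical `ℤ_[p]`-linear map `T_p A → V_p A`, `x ↦ 1 ⊗ x` (injective, since `T_p A` is
always `ℤ_p`-torsion-free). Serre (1968), I.1.1. [cite: Serre1968] -/
def TateModule.toRational : TateModule A p →ₗ[ℤ_[p]] RationalTateModule A p :=
  (TensorProduct.mk ℤ_[p] ℚ_[p] (TateModule A p) 1 :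
    TateModule A p →ₗ[ℤ_[p]] ℚ_[p] ⊗[ℤ_[p]] TateModule A p)

/-- Unfolding `TateModule.toRational`: `toRational x = 1 ⊗ₜ x`. [folklore] -/
theorem TateModule.toRational_apply (x : TateModule A p) :
    TateModule.toRational p x = ((1 : ℚ_[p]) ⊗ₜ[ℤ_[p]] x : ℚ_[p] ⊗[ℤ_[p]] TateModule A p) :=
  rfl

variable [DistribMulAction G A]

/-- The rational `p`-adic representation `G → Aut_{ℚ_p}(V_p A)`: base change to `ℚ_[p]` of
`tateRepresentation G A p` (Mathlib `Module.End.baseChangeHom`, `σ ↦ 1 ⊗ ρ(σ)`).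
Silverman, *AEC*, III.§7; Serre (1968), I.1.1–1.2. [cite: Serre1968] -/
def rationalTateRepresentation : Representation ℚ_[p] G (RationalTateModule A p) :=
  ((Module.End.baseChangeHom ℤ_[p] ℚ_[p] (TateModule A p)).toMonoidHom.comp
    (tateRepresentation G A p) : G →* Module.End ℚ_[p] (ℚ_[p] ⊗[ℤ_[p]] TateModule A p))

variable {G A p} in
/-- Unfolding `rationalTateRepresentation` on pure tensors: `ρ_V(g) (c ⊗ x) = c ⊗ (g • x)`. [folklore] -/
@[simp]
theorem rationalTateRepresentation_apply_tmul (g : G) (c : ℚ_[p]) (x : TateModule A p) :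
    rationalTateRepresentation G A p g
      ((c ⊗ₜ[ℤ_[p]] x : ℚ_[p] ⊗[ℤ_[p]] TateModule A p) : RationalTateModule A p) =
      ((c ⊗ₜ[ℤ_[p]] (g • x) : ℚ_[p] ⊗[ℤ_[p]] TateModule A p) : RationalTateModule A p) :=
  rfl

/-- `rationalTateRepresentation` extends `tateRepresentation` along `toRational`. [folklore] -/
theorem rationalTateRepresentation_toRational (g : G) (x : TateModule A p) :
    rationalTateRepresentation G A p g (TateModule.toRational p x) =
      TateModule.toRational p (g • x) :=
  rfl

end Rational

end Literature.NumberTheory.EllipticCurves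

/-! ## The Tate module of an elliptic curve -/

namespace WeierstrassCurve

open Literature.NumberTheory.EllipticCurves

variable {F : Type u} [Field F] (W : WeierstrassCurve F) (p : ℕ)

/-- The `p`-adic **Tate module** `T_p E = lim← E[p^n]` of a Weierstrass curve `W` (`E`) over `F`,
built from the geometric points `E(F̄) = geomPoints W`: `Literature.TateModule (geomPoints W) p`. It
carries the (profinite) subspace topology of `ℕ → E(F̄)` (`E(F̄)` discrete) and the componentwise
action of `Γ_F`. Silverman, *AEC*, III.§7, Definition. [folklore] -/
abbrev tateModule : Type u := TateModule (geomPoints W) p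

/-- The `p`-primary torsion `E[p^∞] = ⋃ₙ E[p^n] ⊆ E(F̄)` (Mathlib's
`AddCommGroup.primaryComponent`), with its `Γ_F`-action
(`Literature.NumberTheory.EllipticCurves.primaryComponent.instDistribMulAction`). Silverman, *AEC*, III.§7. [folklore] -/
abbrev geomPrimaryTorsion : AddSubgroup (geomPoints W) :=
  AddCommGroup.primaryComponent (geomPoints W) p

/-- The `n`-th component of an element of `T_p E` is a geometric `p ^ n`-torsion point.
Silverman, *AEC*, III.§7. [folklore] -/
theorem proj_tateModule_mem_geomTorsion (n : ℕ) (a : W.tateModule p) :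
    TateModule.proj p n a ∈ geomTorsion W (p ^ n : ℕ) :=
  TateModule.proj_mem_torsionBy n a

variable [Fact p.Prime]

/-- The rational Tate module `V_p E = ℚ_p ⊗_{ℤ_p} T_p E` of `W`, with its module topology over
`ℚ_[p]`: `Literature.RationalTateModule (geomPoints W) p`. Silverman, *AEC*, III.§7; Serre (1968), I.1.2. [cite: Serre1968] -/
abbrev rationalTateModule : Type u := RationalTateModule (geomPoints W) p

/-- The `p`-adic Galois representation `ρ_{E,p} : Γ_F → Aut_{ℤ_p}(T_p E)` of `W`
(`Literature.NumberTheory.EllipticCurves.tateRepresentation` for the `Γ_F`-action on `E(F̄)`). Silverman, *AEC*, III.§7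
("the `ℓ`-adic representation"); Serre (1968), I.1.2 and IV.1.3. [cite: Serre1968] -/
def galoisRepTate : Representation ℤ_[p] (Field.absoluteGaloisGroup F) (W.tateModule p) :=
  tateRepresentation (Field.absoluteGaloisGroup F) (geomPoints W) p

/-- Unfolding `galoisRepTate`: `ρ_{E,p}(σ) a = σ • a` (componentwise action). [folklore] -/
@[simp]
theorem galoisRepTate_apply_apply (σ : Field.absoluteGaloisGroup F) (a : W.tateModule p) :
    galoisRepTate W p σ a = σ • a :=
  rfl

/-- The rational `p`-adic Galois representation `Γ_F → Aut_{ℚ_p}(V_p E)` of `W`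
(`Literature.NumberTheory.EllipticCurves.rationalTateRepresentation`). Silverman, *AEC*, III.§7; Serre (1968), I.1.2. [cite: Serre1968] -/
def rationalGaloisRepTate :
    Representation ℚ_[p] (Field.absoluteGaloisGroup F) (W.rationalTateModule p) :=
  rationalTateRepresentation (Field.absoluteGaloisGroup F) (geomPoints W) p

/-! ### Structure theorems (Silverman, *AEC*, III.7.1) -/

/-- The Tate module of an elliptic curve is a free `ℤ_p`-module (of rank `2` if `p ≠ char F`,
of rank `0` or `1` if `p = char F`). Silverman, *AEC*, III.7.1(a) and III.6.4. Consumed downstream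
only as an explicit hypothesis, never as an instance. [cite: SilvermanAEC2009, Prop. III.7.1(a) with Cor. III.6.4] -/
def module_free_tateModule : Prop :=
  ∀ [W.IsElliptic],
    Module.Free ℤ_[p] (W.tateModule p)

/-- The Tate module of an elliptic curve is a finitely generated `ℤ_p`-module.
Silverman, *AEC*, III.7.1(a) and III.6.4. Consumed downstream only as an explicit hypothesis. [cite: SilvermanAEC2009, Prop. III.7.1(a) with Cor. III.6.4] -/
def module_finite_tateModule : Prop :=
  ∀ [W.IsElliptic],
    Module.Finite ℤ_[p] (W.tateModule p)

/-- For an elliptic curve and a prime `p ≠ char F`, `T_p E ≅ ℤ_p × ℤ_p`, i.e.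
`rank_{ℤ_p} T_p E = 2`. Silverman, *AEC*, III.7.1(a), p. 83 (reduced to `card_torsionPoints_eq_sq`,
III.6.4(b), in the sibling file `TateModuleProofs`). [cite: SilvermanAEC2009, Prop. III.7.1(a)] -/
def finrank_tateModule_eq_two : Prop :=
  ∀ [W.IsElliptic] (hp : (p : F) ≠ 0),
    Module.finrank ℤ_[p] (W.tateModule p) = 2

/-- The rational Tate module of an elliptic curve is a finite-dimensional `ℚ_p`-vector space.
Silverman, *AEC*, III.7.1. Consumed downstream only as an explicit hypothesis. [cite: SilvermanAEC2009, Prop. III.7.1] -/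
def module_finite_rationalTateModule : Prop :=
  ∀ [W.IsElliptic],
    Module.Finite ℚ_[p] (W.rationalTateModule p)

/-- For an elliptic curve and a prime `p ≠ char F`, `dim_{ℚ_p} V_p E = 2`.
Silverman, *AEC*, III.7.1(a) (`T_ℓ(E) ≅ ℤ_ℓ × ℤ_ℓ` for `ℓ ≠ char K`, p. 83) with Remark 7.2 (tensoring
with `ℚ_ℓ` gives a two-dimensional `ℚ_ℓ`-representation); the printed III.7.1(b) is the case
`p = char K`. Reduced to `card_torsionPoints_eq_sq` (III.6.4(b)) by
`finrank_rationalTateModule_eq_two_of_card_torsionPoints_eq_sq` in the sibling file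
`TateModuleProofs`. [cite: SilvermanAEC2009, Prop. III.7.1(a) with Remark 7.2, p. 83] -/
def finrank_rationalTateModule_eq_two : Prop :=
  ∀ [W.IsElliptic] (hp : (p : F) ≠ 0),
    Module.finrank ℚ_[p] (W.rationalTateModule p) = 2

/-- The Galois action `Γ_F × T_p E → T_p E` is (jointly) continuous for the Krull topology on
`Γ_F` and the profinite topology on `T_p E` (each `E[p^n]` is a finite discrete `Γ_F`-module).
Silverman, *AEC*, III.§7 (Remark 7.1); Serre (1968), I.1.1–1.2. [cite: Serre1968] -/
def continuous_galoisRepTate : Prop :=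
  Continuous fun x : Field.absoluteGaloisGroup F × W.tateModule p ↦
      galoisRepTate W p x.1 x.2

/-- The Galois action `Γ_F × V_p E → V_p E` is continuous for the module topology on the
finite-dimensional `ℚ_p`-vector space `V_p E`. Serre (1968), I.1.1–1.2. [cite: Serre1968] -/
def continuous_rationalGaloisRepTate : Prop :=
  ∀ [W.IsElliptic],
    Continuous fun x : Field.absoluteGaloisGroup F × W.rationalTateModule p ↦
      rationalGaloisRepTate W p x.1 x.2

/-- Over the algebraically closed field `F̄`, multiplication by `p` is surjective on `E(F̄)`, so
every geometric `p ^ n`-torsion point is the `n`-th component of an element of `T_p E`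
(the projections `T_p E → E[p^n]` are surjective). Silverman, *AEC*, III.4.10(a), III.§7. [cite: SilvermanAEC2009, Cor. III.4.10(a) with III.§7] -/
def proj_surjective_of_isAlgClosed : Prop :=
  ∀ [W.IsElliptic] (n : ℕ) {P : geomPoints W} (hP : P ∈ geomTorsion W (p ^ n : ℕ)),
    ∃ a : W.tateModule p, TateModule.proj p n a = P

/-! ### Glue to `Literature.NumberTheory.GaloisRepresentations.GaloisRep` -/

/-- The `p`-adic Tate module as a continuous Galois representation
`Literature.GaloisRep F ℤ_[p] (T_p E)` (item G09 `GaloisRep`), given a proof `h` of joint continuity of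
the action — supplied by `continuous_galoisRepTate W p` (a sorried theorem, hence an explicit
argument rather than baked into the definition). Serre (1968), I.1.2. [cite: Serre1968] -/
def tateGaloisRep
    (h : Continuous fun x : Field.absoluteGaloisGroup F × W.tateModule p ↦
      galoisRepTate W p x.1 x.2) :
    Literature.NumberTheory.GaloisRepresentations.GaloisRep F ℤ_[p] (W.tateModule p) :=
  ⟨galoisRepTate W p, h⟩

/-- The underlying representation of `tateGaloisRep` is `galoisRepTate`. [folklore] -/
@[simp]
theorem tateGaloisRep_toRepresentation
    (h : Continuous fun x : Field.absoluteGaloisGroup F × W.tateModule p ↦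
      galoisRepTate W p x.1 x.2) :
    (tateGaloisRep W p h).toRepresentation = galoisRepTate W p :=
  rfl

/-- The rational Tate module as a continuous Galois representation
`Literature.GaloisRep F ℚ_[p] (V_p E)`, given a proof `h` of joint continuity — supplied by
`continuous_rationalGaloisRepTate W p`. Serre (1968), I.1.2. [cite: Serre1968] -/
def rationalTateGaloisRep
    (h : Continuous fun x : Field.absoluteGaloisGroup F × W.rationalTateModule p ↦
      rationalGaloisRepTate W p x.1 x.2) :
    Literature.NumberTheory.GaloisRepresentations.GaloisRep F ℚ_[p] (W.rationalTateModule p) :=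
  ⟨rationalGaloisRepTate W p, h⟩

/-- The underlying representation of `rationalTateGaloisRep` is `rationalGaloisRepTate`. [folklore] -/
@[simp]
theorem rationalTateGaloisRep_toRepresentation
    (h : Continuous fun x : Field.absoluteGaloisGroup F × W.rationalTateModule p ↦
      rationalGaloisRepTate W p x.1 x.2) :
    (rationalTateGaloisRep W p h).toRepresentation = rationalGaloisRepTate W p :=
  rfl

end WeierstrassCurve
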